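import Literature.Computability.Cryptography.LWENormalForm
import Literature.Computability.Cryptography.LWESecretLaws
import Literature.Computability.Cryptography.LWEProductLaws
import Literature.Computability.Cryptography.CenteredBinomialMLWE
import Literature.Computability.Cryptography.ModuleLWER
import HarnessLib

/-!
# Kyber.CPAPKE is IND-CPA secure under Module-LWE (Kyber specification v3.02, Theorem 1) — the
# algebraic scheme and the hybrid proof

Topic `Computability/Cryptography`. CRYSTALS-Kyber specification v3.02, §4.3.1 "Tight reduction from
MLWE in the ROM", verbatim (p. 20):

> "We first note that Kyber.CPAPKE is tightly IND-CPA secure under the Module-LWE hardness assumption.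
> **Theorem 1.** Suppose `XOF` and `G` are random oracles. For any adversary `A`, there exist adversaries
> `B` and `C` with roughly the same running time as that of `A` such that
> `Adv^{cpa}_{Kyber.CPAPKE}(A) ≤ 2 · Adv^{mlwe}_{k+1,k,η}(B) + Adv^{prf}_{PRF}(C)`.
> The proof of this theorem is easily obtained by noting that, under the MLWE assumption, public-key
> and ciphertext are pseudo-random." [AvanziEtAl2021KyberSpec, §4.3.1 Thm 1]

with `Adv^{mlwe}_{m,k,η}` the normal-form Module-LWE advantage of §4.3 (the tree's
`RingLWE.binomialMLWEAdvantage`, `CenteredBinomialMLWE.lean`) and Kyber.CPAPKE the scheme of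
Algorithms 4–6, whose algebraic content the specification itself annotates in the margin:
"`pk := As + e`" (Alg. 4, `s, e ← β_η`), "`u := Aᵀr + e₁`", "`v := tᵀr + e₂ + Decompress_q(m, 1)`",
"`c := (Compress_q(u, d_u), Compress_q(v, d_v))`" (Alg. 5, `r ← β_η`, `e₁, e₂ ← β_η`),
"`m := Compress_q(v − sᵀu, 1)`" (Alg. 6). [AvanziEtAl2021KyberSpec, §1 Algorithms 4–6]

## What is formalised

The theorem is proved here in exactly the idealised model in which it is stated — the matrix `A` uniform
(`XOF` a random oracle) and the noise truly random (the `Adv^{prf}` term prices the pseudo-random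
sampling from a seed, which is not modelled) — for the ALGEBRAIC SKELETON of Kyber.CPAPKE over an
arbitrary finite commutative ring `R` (ML-KEM: `R = R_q = ℤ_3329[X]/(X^256 + 1)`), rank `k` and noise
law `χ` (ML-KEM: `D_η(R_q)`), with the message an arbitrary ring element `μ` added to `v` (Kyber:
`μ = Decompress_q(m, 1) = ⌈q/2⌋·m`) and WITHOUT the final ciphertext compression (a public
deterministic post-processing of `(u, v)`; `KyberPKE.cpaAdvantage_postprocess` records that it cannot
increase any adversary's advantage, so the bound transfers to the compressed scheme verbatim):

* `KyberPKE.keyGen χ k` — `s ← χ^k`; `pk` = the `k` samples `(aᵢ, ⟨aᵢ, s⟩ + eᵢ)` = the rows of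
  `(A, t = As + e)`, `A ← U(R^{k×k})`, `e ← χ^k`; `sk = s`;
* `KyberPKE.enc χ k pk μ` — `r, e₁ ← χ^k`, `e₂ ← χ`; `u = Aᵀr + e₁`, `v = tᵀr + e₂ + μ`
  (`encDet` is the deterministic core); `KyberPKE.dec` — `v − sᵀu`, and `dec_encDet`: it equals
  `μ + (eᵀr + e₂ − sᵀe₁)` (the decryption-noise term Kyber rounds away);
* `KyberPKE.CPAAdversary` (two stages `choose`/`guess` with private state), `KyberPKE.cpaGame`
  (keys; adversary picks `μ₀, μ₁`; hidden fair bit `b`; challenge `Enc(pk, μ_b)`; adversary's guess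
  compared with `b`) and `KyberPKE.cpaAdvantage A = |Pr[guess = b] − 1/2|`;
* the two reductions of the hybrid argument: `KyberPKE.redKey A` (an MLWE distinguisher on `k`
  samples: use them as the public key — "the public key is pseudo-random") and `KyberPKE.redCipher A`
  (on `k + 1` samples: sample `0` supplies `t` and `v − μ_b`, samples `1 … k` supply the COLUMNS of `A`
  and `u` — "the ciphertext is pseudo-random");
* the hybrid identities `cpaGame_eq` (real game = `redKey` on normal-form MLWE samples),
  `hybrid_eq` (`redKey` on uniform samples = `redCipher` on `k + 1` normal-form MLWE samples),
  `uniform_bind_redCipher` (`redCipher` on uniform samples = a fair coin), and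
* **`KyberPKE.cpaAdvantage_le`**: `Adv^{cpa}(A) ≤ Adv^{mlwe}_{k,k}(redKey A) + Adv^{mlwe}_{k+1,k}(redCipher A)`,
  **`KyberPKE.exists_cpaAdvantage_le_two_mul`**: `∃ B, Adv^{cpa}(A) ≤ 2 · Adv^{mlwe}_{k+1,k}(B)` (the
  printed form; `Adv^{mlwe}_{k,k} ≤ Adv^{mlwe}_{k+1,k}` by dropping a sample, `advantage_dropSample`),
  and the ML-KEM instance **`MLKEM.cpaPKE_exists_le_two_mul_mlweAdvantage`** over
  `R_q = 𝓞(ℚ(ζ_512)) ⧸ (3329)`, `χ = D_η(R_q)`, stated with `MLKEM.mlweAdvantage k η (k + 1)`.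

* **Two noise laws (the Kyber512 shape).** Kyber512 draws `s, e, r ← β_{η₁}` and `e₁, e₂ ← β_{η₂}`
  with `η₁ = 3 > η₂ = 2` (§1.4, p. 11: "The parameter `η₁` defines the noise of `s` and `e` in Algorithm 4
  and of `r` in Algorithm 5. The parameter `η₂` defines the noise of `e₁` and `e₂` in Algorithm 5"), and
  §4.4 replaces the term `2·Adv^{mlwe}_{k+1,k,η}` of Theorem 1 by eq. (6). The variants `enc₂ χ₁ χ₂`,
  `cpaGame₂`, `cpaAdvantage₂`, `redKey₂` (all `rfl`-equal to the one-law versions at `χ₁ = χ₂`), the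
  hybrids `cpaGame₂_eq` / `hybrid₂_eq` and **`KyberPKE.cpaAdvantage₂_le`** give the exactly provable
  two-term bound `Adv^{cpa}(A) ≤ Adv^{mlwe}_{k,k,η₁}(redKey₂ A) + Adv^{mlwe}_{k+1,k,η₁,η₂}(redCipher A)`
  (second term: secret width `η₁`, error width `η₂` — the tree's two-parameter
  `RingLWE.binomialMLWEAdvantage₂` of `ModuleLWER.lean`), ML-KEM instance
  **`MLKEM.cpaPKE₂_le_mlweAdvantage_add`**. The further replacement of the second term by the
  Module-LWER advantage in eq. (6) (compressed ciphertext) is NOT typed here.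

The MLWE advantages are the tree's `LWE.advantageSecretLaw χₑ (LWE.iidPMF χₛ k) m`
(`LWESecretLaws.lean`: error law `χₑ`, secret law `χₛ^k`, `m` samples), which for
`χ = D_η(R_q)` is `RingLWE.binomialMLWEAdvantage` (one law) resp. `RingLWE.binomialMLWEAdvantage₂`
(two laws) DEFINITIONALLY (`advantageSecretLaw_binomialRq`, `advantageSecretLaw_binomialRq₂`).

## References

* R. Avanzi, J. Bos, L. Ducas, E. Kiltz, T. Lepoint, V. Lyubashevsky, J. M. Schanck, P. Schwabe,
  G. Seiler, D. Stehlé, *CRYSTALS-Kyber: Algorithm Specifications and Supporting Documentation*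
  (version 3.02, 2021-08-04): §1 Algorithms 4–6 (Kyber.CPAPKE) with their marginal annotations, §1.4
  (p. 11: which of `s, e, r, e₁, e₂` use `η₁`/`η₂`), §4.3 (`Adv^{mlwe}_{m,k,η}`), §4.3.1 Theorem 1 (p. 20),
  §4.4 eq. (6) (p. 22). Held as paper:url-5bd2326281fb (p0008–p0009, p0011, p0019–p0022).
  [AvanziEtAl2021KyberSpec]
* O. Regev, *On lattices, learning with errors, random linear codes, and cryptography*, J. ACM 56
  (2009), §2/§4 (the sample model `A_{s,χ}`, `m` independent samples, the uniform reference
  distribution). [RegevLWE2009]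
-/

noncomputable section

open scoped ENNReal

namespace Literature.Computability.Cryptography

/-! ### Two generic facts about iid tuples -/

namespace LWE

variable {α : Type}

/-- `m` independent uniform samples are uniform on `m`-tuples (Regev 2009 §4: the reference
distribution "`U`" on tuples). [cite: RegevLWE2009, §4 (samples from the uniform distribution U)] -/
theorem iidPMF_uniformOfFintype [Fintype α] [Nonempty α] (m : ℕ) :
    iidPMF (PMF.uniformOfFintype α) m = PMF.uniformOfFintype (Fin m → α) := by
  ext v
  rw [PMF.uniformOfFintype_apply, iidPMF_apply_holds]
  simp only [PMF.uniformOfFintype_apply, Finset.prod_const, Finset.card_univ, Fintype.card_fin,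
    Fintype.card_fun, Nat.cast_pow, ENNReal.inv_pow]

/-- Dropping the first of `m + 1` independent samples leaves `m` independent samples
(Regev 2009 §2: "`m` independent samples from `A_{s,χ}`" for every `m`). [cite: RegevLWE2009, §2 (m independent samples)] -/
theorem iidPMF_succ_map_tail (p : PMF α) (m : ℕ) :
    (iidPMF p (m + 1)).map (fun v ↦ Fin.tail v) = iidPMF p m := by
  rw [iidPMF_succ, PMF.map_bind]
  have h : ∀ x : α, ((iidPMF p m).map fun v ↦ (Fin.cons x v : Fin (m + 1) → α)).map
      (fun v ↦ Fin.tail v) = iidPMF p m := fun x ↦ by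
    rw [PMF.map_comp]
    have hc : ((fun v : Fin (m + 1) → α ↦ Fin.tail v) ∘ fun v : Fin m → α ↦
        (Fin.cons x v : Fin (m + 1) → α)) = id := by
      funext v
      exact Fin.tail_cons (α := fun _ ↦ α) x v
    rw [hc, PMF.map_id]
  simp_rw [h]
  exact PMF.bind_const _ _

end LWE

/-! ### The scheme: Kyber.CPAPKE over a finite commutative ring `R`, rank `k`, noise law `χ` -/

namespace KyberPKE

variable {R : Type} [CommRing R] [Fintype R] (χ : PMF R) (k : ℕ)

/-- A public key: the `k` rows `(aᵢ, tᵢ)` of `(A, t)`, `A ∈ R^{k×k}`, `t ∈ R^k` — literally a tuple of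
`k` LWE samples. [cite: AvanziEtAl2021KyberSpec, §1 Algorithm 4 ("pk := As + e")] -/
abbrev PubKey (R : Type) (k : ℕ) : Type := Fin k → (Fin k → R) × R

/-- A ciphertext `(u, v) ∈ R^k × R` (before compression). [cite: AvanziEtAl2021KyberSpec, §1 Algorithm 5 ("c := (Compress_q(u, d_u), Compress_q(v, d_v))")] -/
abbrev Cipher (R : Type) (k : ℕ) : Type := (Fin k → R) × R

/-- Column `j` of the matrix `A` of a public key. [cite: AvanziEtAl2021KyberSpec, §1 Algorithm 5 ("u := Aᵀr + e₁")] -/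
def col (pk : PubKey R k) (j : Fin k) : Fin k → R := fun i ↦ (pk i).1 j

/-- The vector `t` of a public key. [cite: AvanziEtAl2021KyberSpec, §1 Algorithm 4 ("pk := As + e")] -/
def tvec (pk : PubKey R k) : Fin k → R := fun i ↦ (pk i).2

/-- **Kyber.CPAPKE.KeyGen**, algebraic skeleton: `s ← χ^k`, `A ← U(R^{k×k})`, `e ← χ^k`,
`pk := (A, t = As + e)` (as its `k` rows `(aᵢ, ⟨aᵢ, s⟩ + eᵢ)` = `k` samples of `A_{s,χ}`), `sk := s`.
[cite: AvanziEtAl2021KyberSpec, §1 Algorithm 4 ("pk := As + e"; s, e ← β_η)] -/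
def keyGen : PMF (PubKey R k × (Fin k → R)) :=
  (LWE.iidPMF χ k).bind fun s ↦ (LWE.lweSamples χ s k).map fun pk ↦ (pk, s)

/-- The deterministic core of encryption, given the randomness `(r, e₁, e₂)`:
`u := Aᵀr + e₁` (`u_j = ⟨column j of A, r⟩ + e₁,j`), `v := tᵀr + e₂ + μ`.
[cite: AvanziEtAl2021KyberSpec, §1 Algorithm 5 ("u := Aᵀr + e₁", "v := tᵀr + e₂ + Decompress_q(m, 1)")] -/
def encDet (pk : PubKey R k) (μ : R) (r e₁ : Fin k → R) (e₂ : R) : Cipher R k :=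
  (fun j ↦ col k pk j ⬝ᵥ r + e₁ j, tvec k pk ⬝ᵥ r + e₂ + μ)

/-- **Kyber.CPAPKE.Enc**, algebraic skeleton: `r ← χ^k`, `e₁ ← χ^k`, `e₂ ← χ`, output
`(u, v) = (Aᵀr + e₁, tᵀr + e₂ + μ)` (no compression). [cite: AvanziEtAl2021KyberSpec, §1 Algorithm 5 (r ← β_η, e₁, e₂ ← β_η; "u := Aᵀr + e₁", "v := tᵀr + e₂ + Decompress_q(m, 1)")] -/
def enc (pk : PubKey R k) (μ : R) : PMF (Cipher R k) :=
  (LWE.iidPMF χ k).bind fun r ↦ (LWE.iidPMF χ k).bind fun e₁ ↦ χ.map fun e₂ ↦ encDet k pk μ r e₁ e₂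

/-- **Kyber.CPAPKE.Dec**, algebraic skeleton: `v − sᵀu` (Kyber then decodes `m := Compress_q(·, 1)`).
[cite: AvanziEtAl2021KyberSpec, §1 Algorithm 6 ("m := Compress_q(v − sᵀu, 1)")] -/
def dec (s : Fin k → R) (c : Cipher R k) : R := c.2 - s ⬝ᵥ c.1

omit [Fintype R] in
/-- The decryption equation: for a public key `(A, As + e)` and a ciphertext of `μ` with randomness
`(r, e₁, e₂)`, `v − sᵀu = μ + (eᵀr + e₂ − sᵀe₁)` — the message plus the decryption noise that the
final `Compress_q(·, 1)` must round away. [cite: AvanziEtAl2021KyberSpec, §1 Algorithms 4–6 (pk := As + e, u := Aᵀr + e₁, v := tᵀr + e₂ + ⌈q/2⌋m, m := Compress_q(v − sᵀu, 1))] -/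
theorem dec_encDet (pk : PubKey R k) (s e : Fin k → R) (hpk : ∀ i, (pk i).2 = (pk i).1 ⬝ᵥ s + e i)
    (μ : R) (r e₁ : Fin k → R) (e₂ : R) :
    dec k s (encDet k pk μ r e₁ e₂) = μ + (e ⬝ᵥ r + e₂ - s ⬝ᵥ e₁) := by
  have ht : tvec k pk = fun i ↦ (pk i).1 ⬝ᵥ s + e i := funext hpk
  simp only [dec, encDet, ht, col, dotProduct, Finset.sum_add_distrib, add_mul, mul_add,
    Finset.mul_sum, Finset.sum_mul]
  have hswap : ∑ i, ∑ j, (pk i).1 j * s j * r i = ∑ j, ∑ i, s j * ((pk i).1 j * r i) := by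
    rw [Finset.sum_comm]
    exact Finset.sum_congr rfl fun j _ ↦ Finset.sum_congr rfl fun i _ ↦ by ring
  rw [hswap]
  ring

/-! ### The IND-CPA game -/

/-- An IND-CPA adversary against the scheme with rank `k` over `R`: a first stage that, given the
public key, outputs two messages and a private state, and a second stage that, given the state and the
challenge ciphertext, outputs a guess. Both stages are arbitrary Markov kernels.
[cite: AvanziEtAl2021KyberSpec, §4.3.1 Thm 1 (Adv^cpa_{Kyber.CPAPKE}(A))] -/
structure CPAAdversary (R : Type) (k : ℕ) where
  /-- The type of the private state passed from `choose` to `guess`. -/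
  St : Type
  /-- Stage 1: on `pk`, choose `(μ₀, μ₁, state)`. -/
  choose : PubKey R k → PMF (R × R × St)
  /-- Stage 2: on `(state, challenge ciphertext)`, guess the hidden bit. -/
  guess : St → Cipher R k → PMF Bool

/-- A fair coin. [cite: AvanziEtAl2021KyberSpec, §4.3.1 Thm 1 (the hidden bit of the IND-CPA game)] -/
def coin : PMF Bool := PMF.uniformOfFintype Bool

/-- The challenge message `μ_b`. [cite: AvanziEtAl2021KyberSpec, §4.3.1 Thm 1 (IND-CPA game)] -/
def pick {S : Type} (b : Bool) (m : R × R × S) : R := if b then m.2.1 else m.1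

/-- **The IND-CPA game** of Kyber.CPAPKE (idealised): `(pk, sk) ← KeyGen`; `(μ₀, μ₁, st) ← A.choose pk`;
`b ← {0,1}`; `c ← Enc(pk, μ_b)`; `b′ ← A.guess st c`; output `[b′ = b]`.
[cite: AvanziEtAl2021KyberSpec, §4.3.1 Thm 1 (Adv^cpa_{Kyber.CPAPKE}(A))] -/
def cpaGame (A : CPAAdversary R k) : PMF Bool :=
  (keyGen χ k).bind fun ks ↦ (A.choose ks.1).bind fun m ↦ coin.bind fun b ↦
    (enc χ k ks.1 (pick b m)).bind fun c ↦ (A.guess m.2.2 c).map fun b' ↦ (b' == b)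

/-- **`Adv^{cpa}_{Kyber.CPAPKE}(A) = |Pr[b′ = b] − 1/2|`.** [cite: AvanziEtAl2021KyberSpec, §4.3.1 Thm 1 (Adv^cpa_{Kyber.CPAPKE}(A))] -/
def cpaAdvantage (A : CPAAdversary R k) : ℝ := |(cpaGame χ k A true).toReal - 1 / 2|

/-- The normal-form MLWE advantage consumed by Theorem 1, `Adv^{mlwe}_{m,k}` with secret AND error
law `χ` (the tree's `LWE.advantageSecretLaw χ (χ^k) m`), is `RingLWE.binomialMLWEAdvantage` for
`χ = D_η(R_q)` — definitionally. [cite: AvanziEtAl2021KyberSpec, §4.3 (Adv^mlwe_{m,k,η})] -/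
theorem advantageSecretLaw_binomialRq {K : Type} [Field K] [NumberField K] {n : ℕ}
    (b : Module.Basis (Fin n) ℤ (NumberField.RingOfIntegers K)) (q : ℕ) [NeZero q] (k η m : ℕ)
    (D : LWE.Distinguisher (Fin k) (RingLWE.Rq K q) m) :
    LWE.advantageSecretLaw (RingLWE.binomialRq b q η) (LWE.iidPMF (RingLWE.binomialRq b q η) k) m D =
      RingLWE.binomialMLWEAdvantage b q k η m D := rfl

/-- A public deterministic post-processing of the challenge ciphertext (e.g. Kyber's compression
`(u, v) ↦ (Compress_q(u, d_u), Compress_q(v, d_v))`) cannot help: an adversary `A` that expects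
post-processed ciphertexts is the adversary `A ∘ T` against the uncompressed scheme, with the same
game. [cite: AvanziEtAl2021KyberSpec, §1 Algorithm 5 ("c := (Compress_q(u, d_u), Compress_q(v, d_v))")] -/
theorem cpaAdvantage_postprocess {C : Type} (T : Cipher R k → C) (St : Type)
    (choose : PubKey R k → PMF (R × R × St)) (guess : St → C → PMF Bool) :
    cpaAdvantage χ k ⟨St, choose, fun st c ↦ guess st (T c)⟩ =
      |(((keyGen χ k).bind fun ks ↦ (choose ks.1).bind fun m ↦ coin.bind fun b ↦
          ((enc χ k ks.1 (pick b m)).map T).bind fun c ↦ (guess m.2.2 c).map fun b' ↦ (b' == b))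
        true).toReal - 1 / 2| := by
  simp only [cpaAdvantage, cpaGame, PMF.bind_map]
  rfl

/-! ### The two reductions -/

/-- **`B₁` ("the public key is pseudo-random")**: an MLWE distinguisher on `k` samples — use the samples
AS the public key and run the whole IND-CPA game. [cite: AvanziEtAl2021KyberSpec, §4.3.1 Thm 1 (proof: "under the MLWE assumption, public-key … pseudo-random")] -/
def redKey (A : CPAAdversary R k) : LWE.Distinguisher (Fin k) R k :=
  fun pk ↦ (A.choose pk).bind fun m ↦ coin.bind fun b ↦
    (enc χ k pk (pick b m)).bind fun c ↦ (A.guess m.2.2 c).map fun b' ↦ (b' == b)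

/-- Reassembling a public key from `k + 1` samples: sample `0` carries `t`, sample `j + 1` carries
COLUMN `j` of `A`. [cite: AvanziEtAl2021KyberSpec, §4.3.1 Thm 1 (proof: "… and ciphertext are pseudo-random")] -/
def asmPK (S : Fin (k + 1) → (Fin k → R) × R) : PubKey R k :=
  fun i ↦ (fun j ↦ (S j.succ).1 i, (S 0).1 i)

/-- Reassembling the challenge ciphertext from `k + 1` samples and the challenge message: `u_j` is the
`b`-part of sample `j + 1`, `v` is the `b`-part of sample `0` plus `μ`.
[cite: AvanziEtAl2021KyberSpec, §4.3.1 Thm 1 (proof: "… and ciphertext are pseudo-random")] -/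
def asmCT (S : Fin (k + 1) → (Fin k → R) × R) (μ : R) : Cipher R k :=
  (fun j ↦ (S j.succ).2, (S 0).2 + μ)

/-- **`B₂` ("the ciphertext is pseudo-random")**: an MLWE distinguisher on `k + 1` samples — read the
`a`-parts as `(t, columns of A)`, i.e. as a uniformly random public key, and the `b`-parts as the
challenge ciphertext of `μ_b` minus `(0, μ_b)`. [cite: AvanziEtAl2021KyberSpec, §4.3.1 Thm 1 (proof: "… and ciphertext are pseudo-random")] -/
def redCipher (A : CPAAdversary R k) : LWE.Distinguisher (Fin k) R (k + 1) :=
  fun S ↦ (A.choose (asmPK k S)).bind fun m ↦ coin.bind fun b ↦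
    (A.guess m.2.2 (asmCT k S (pick b m))).map fun b' ↦ (b' == b)

/-! ### The hybrid argument -/

/-- **Hybrid 0**: the real game IS `B₁` run on `k` normal-form MLWE samples (the public key `(A, As + e)`
is such a tuple). [cite: AvanziEtAl2021KyberSpec, §4.3.1 Thm 1 (proof)] -/
theorem cpaGame_eq (A : CPAAdversary R k) :
    cpaGame χ k A = (LWE.lweSamplesSecretLaw χ (LWE.iidPMF χ k) k).bind (redKey χ k A) := by
  rw [cpaGame, keyGen, LWE.lweSamplesSecretLaw, PMF.bind_bind, PMF.bind_bind]
  refine congrArg _ (funext fun s ↦ ?_)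
  rw [PMF.bind_map]
  rfl

/-- The `a`-parts of `k + 1` samples, read as `(t, columns of A)`, i.e. `asmPK` as a function of the
`a`-parts alone. [cite: AvanziEtAl2021KyberSpec, §4.3.1 Thm 1 (proof)] -/
def pkOfA (A' : Fin (k + 1) → Fin k → R) : PubKey R k :=
  fun i ↦ (fun j ↦ A' j.succ i, A' 0 i)

/-- Inverse of `pkOfA`. [cite: AvanziEtAl2021KyberSpec, §4.3.1 Thm 1 (proof)] -/
def aOfPk (pk : PubKey R k) : Fin (k + 1) → Fin k → R :=
  Fin.cons (fun i ↦ (pk i).2) (fun j i ↦ (pk i).1 j)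

omit [CommRing R] [Fintype R] in
/-- `pkOfA` is a bijection (a re-indexing of `k(k+1)` ring elements). [cite: AvanziEtAl2021KyberSpec, §4.3.1 Thm 1 (proof)] -/
theorem pkOfA_bijective : Function.Bijective (pkOfA (R := R) k) := by
  refine Function.bijective_iff_has_inverse.mpr ⟨aOfPk k, fun A' ↦ ?_, fun pk ↦ ?_⟩
  · funext j
    refine Fin.cases ?_ (fun j' ↦ ?_) j
    · funext i; simp [aOfPk, pkOfA]
    · funext i; simp [aOfPk, pkOfA]
  · funext i
    simp [aOfPk, pkOfA]

/-- A uniformly random public key is `pkOfA` of `k + 1` independent uniform vectors.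
[cite: RegevLWE2009, §4 (samples from the uniform distribution U)] -/
theorem uniformSamples_eq_map_pkOfA :
    LWE.uniformSamples (Fin k) R k =
      (LWE.iidPMF (PMF.uniformOfFintype (Fin k → R)) (k + 1)).map (pkOfA k) := by
  rw [LWE.iidPMF_uniformOfFintype, LWE.uniformOfFintype_map_of_bijective (pkOfA_bijective k)]
  rfl

/-- The common continuation of both hybrids: public key from the `a`-parts `A'`, messages and state
`m`, hidden bit `b`, encryption randomness `(r, e₁, e₂)`. [cite: AvanziEtAl2021KyberSpec, §4.3.1 Thm 1 (proof)] -/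
def body (A : CPAAdversary R k) (A' : Fin (k + 1) → Fin k → R) (m : R × R × A.St) (b : Bool)
    (r e₁ : Fin k → R) (e₂ : R) : PMF Bool :=
  (A.guess m.2.2 (encDet k (pkOfA k A') (pick b m) r e₁ e₂)).map fun b' ↦ (b' == b)

/-- **Hybrid 1 = Hybrid 1′**: `B₁` on UNIFORM samples (uniform public key, honest ciphertext) has the
same output law as `B₂` on `k + 1` normal-form MLWE samples with secret `r` — the encryption randomness
`r` plays the MLWE secret, `(e₂, e₁)` the MLWE errors, and `(t, columns of A)` the uniform `a`-parts.
[cite: AvanziEtAl2021KyberSpec, §4.3.1 Thm 1 (proof: public key pseudo-random, then ciphertext pseudo-random)] -/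
theorem hybrid_eq (A : CPAAdversary R k) :
    (LWE.uniformSamples (Fin k) R k).bind (redKey χ k A) =
      (LWE.lweSamplesSecretLaw χ (LWE.iidPMF χ k) (k + 1)).bind (redCipher k A) := by
  classical
  set U := LWE.iidPMF (PMF.uniformOfFintype (Fin k → R)) (k + 1) with hU
  -- normal form of the right-hand side
  have hR : (LWE.lweSamplesSecretLaw χ (LWE.iidPMF χ k) (k + 1)).bind (redCipher k A) =
      (LWE.iidPMF χ k).bind fun r ↦ U.bind fun A' ↦ χ.bind fun e₂ ↦ (LWE.iidPMF χ k).bind fun e₁ ↦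
        (A.choose (pkOfA k A')).bind fun m ↦ coin.bind fun b ↦ body k A A' m b r e₁ e₂ := by
    rw [LWE.lweSamplesSecretLaw, PMF.bind_bind]
    refine congrArg _ (funext fun r ↦ ?_)
    rw [LWE.lweSamples_eq_uniform_bind_noise, PMF.bind_bind]
    refine congrArg _ (funext fun A' ↦ ?_)
    rw [PMF.bind_map, LWE.iidPMF_succ, PMF.bind_bind]
    refine congrArg _ (funext fun e₂ ↦ ?_)
    rw [PMF.bind_map]
    rfl
  -- normal form of the left-hand side
  have hL : (LWE.uniformSamples (Fin k) R k).bind (redKey χ k A) =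
      U.bind fun A' ↦ (A.choose (pkOfA k A')).bind fun m ↦ coin.bind fun b ↦
        (LWE.iidPMF χ k).bind fun r ↦ (LWE.iidPMF χ k).bind fun e₁ ↦ χ.bind fun e₂ ↦
          body k A A' m b r e₁ e₂ := by
    rw [uniformSamples_eq_map_pkOfA, PMF.bind_map]
    refine congrArg _ (funext fun A' ↦ ?_)
    simp only [Function.comp_apply, redKey, enc, PMF.bind_bind, PMF.bind_map]
    rfl
  -- commute the independent samplings into the same order
  have c1 : ∀ (A' : Fin (k + 1) → Fin k → R) (m : R × R × A.St),
      (coin.bind fun b ↦ (LWE.iidPMF χ k).bind fun r ↦ (LWE.iidPMF χ k).bind fun e₁ ↦ χ.bind fun e₂ ↦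
        body k A A' m b r e₁ e₂) =
      (LWE.iidPMF χ k).bind fun r ↦ (LWE.iidPMF χ k).bind fun e₁ ↦ χ.bind fun e₂ ↦ coin.bind fun b ↦
        body k A A' m b r e₁ e₂ := by
    intro A' m
    rw [PMF.bind_comm coin]
    refine congrArg _ (funext fun r ↦ ?_)
    rw [PMF.bind_comm coin]
    refine congrArg _ (funext fun e₁ ↦ ?_)
    rw [PMF.bind_comm coin]
  have c2 : ∀ (A' : Fin (k + 1) → Fin k → R),
      ((A.choose (pkOfA k A')).bind fun m ↦ (LWE.iidPMF χ k).bind fun r ↦ (LWE.iidPMF χ k).bind fun e₁ ↦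
        χ.bind fun e₂ ↦ coin.bind fun b ↦ body k A A' m b r e₁ e₂) =
      (LWE.iidPMF χ k).bind fun r ↦ (LWE.iidPMF χ k).bind fun e₁ ↦ χ.bind fun e₂ ↦
        (A.choose (pkOfA k A')).bind fun m ↦ coin.bind fun b ↦ body k A A' m b r e₁ e₂ := by
    intro A'
    rw [PMF.bind_comm (A.choose _)]
    refine congrArg _ (funext fun r ↦ ?_)
    rw [PMF.bind_comm (A.choose _)]
    refine congrArg _ (funext fun e₁ ↦ ?_)
    rw [PMF.bind_comm (A.choose _)]
  rw [hL, hR]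
  simp_rw [c1, c2]
  rw [PMF.bind_comm U]
  refine congrArg _ (funext fun r ↦ ?_)
  refine congrArg _ (funext fun A' ↦ ?_)
  rw [PMF.bind_comm (LWE.iidPMF χ k) χ]

/-- A fair coin compared with an independent bit is a fair coin. [cite: AvanziEtAl2021KyberSpec, §4.3.1 Thm 1 (proof: in the last hybrid the guess is independent of b)] -/
theorem coin_bind_map_beq (X : PMF Bool) : (coin.bind fun b ↦ X.map fun b' ↦ (b' == b)) = coin := by
  have hX : X true + X false = 1 := by
    have h := X.tsum_coe
    rwa [tsum_fintype, Fintype.sum_bool] at h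
  have hc : ∀ b : Bool, coin b = 2⁻¹ := fun b ↦ by
    rw [coin, PMF.uniformOfFintype_apply, Fintype.card_bool]; rfl
  ext c
  rw [PMF.bind_apply, tsum_fintype, Fintype.sum_bool, hc, hc, hc, PMF.map_apply, PMF.map_apply,
    tsum_fintype, tsum_fintype, Fintype.sum_bool, Fintype.sum_bool]
  cases c <;> simp [hX, ← mul_add, add_comm (X false)]

/-- **Hybrid 2**: `B₂` on `k + 1` UNIFORM samples guesses a fair coin — the `b`-part of sample `0` is a
fresh uniform ring element `w`, so the challenge `v = w + μ_b` is uniform whatever `μ_b` is, and the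
adversary's view is independent of `b`. [cite: AvanziEtAl2021KyberSpec, §4.3.1 Thm 1 (proof: "… ciphertext … pseudo-random")] -/
theorem uniform_bind_redCipher (A : CPAAdversary R k) :
    (LWE.uniformSamples (Fin k) R (k + 1)).bind (redCipher k A) = coin := by
  classical
  -- decompose the `k + 1` uniform samples as `Fin.cons (a, w) T`
  have hdec : LWE.uniformSamples (Fin k) R (k + 1) =
      (PMF.uniformOfFintype (Fin k → R)).bind fun a ↦ (PMF.uniformOfFintype R).bind fun w ↦
        (LWE.uniformSamples (Fin k) R k).map fun T ↦ (Fin.cons (a, w) T : Fin (k + 1) → (Fin k → R) × R) := by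
    rw [LWE.uniformSamples_eq_iidPMF_holds, LWE.uniformSamples_eq_iidPMF_holds, LWE.iidPMF_succ]
    nth_rw 1 [← LWE.prodLaw_uniformOfFintype]
    rw [Literature.Probability.Distributions.prodLaw, PMF.bind_bind]
    refine congrArg _ (funext fun a ↦ ?_)
    rw [PMF.bind_map]
    rfl
  -- what `B₂` does with `Fin.cons (a, w) T`
  have hred : ∀ (a : Fin k → R) (w : R) (T : Fin k → (Fin k → R) × R),
      redCipher k A (Fin.cons (a, w) T) =
        (A.choose (fun i ↦ (fun j ↦ (T j).1 i, a i))).bind fun m ↦ coin.bind fun b ↦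
          (A.guess m.2.2 (fun j ↦ (T j).2, w + pick b m)).map fun b' ↦ (b' == b) := by
    intro a w T
    have hpk : asmPK k (Fin.cons (a, w) T) = fun i ↦ (fun j ↦ (T j).1 i, a i) := by
      funext i
      simp only [asmPK, Fin.cons_succ, Fin.cons_zero]
    have hct : ∀ μ : R, asmCT k (Fin.cons (a, w) T) μ = (fun j ↦ (T j).2, w + μ) := fun μ ↦ by
      simp only [asmCT, Fin.cons_succ, Fin.cons_zero]
    simp only [redCipher, hpk, hct]
  -- translation invariance of the uniform `w`
  have htrans : ∀ (μ : R) (g : R → PMF Bool),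
      ((PMF.uniformOfFintype R).bind fun w ↦ g (w + μ)) = (PMF.uniformOfFintype R).bind g := fun μ g ↦ by
    rw [show (fun w ↦ g (w + μ)) = g ∘ (· + μ) from rfl, ← PMF.bind_map,
      LWE.uniformOfFintype_map_of_bijective
        (show Function.Bijective (fun w : R ↦ w + μ) from (Equiv.addRight μ).bijective)]
  rw [hdec, PMF.bind_bind]
  simp_rw [PMF.bind_bind, PMF.bind_map]
  have hinner : ∀ (a : Fin k → R),
      ((PMF.uniformOfFintype R).bind fun w ↦ (LWE.uniformSamples (Fin k) R k).bind
        ((redCipher k A) ∘ fun T ↦ (Fin.cons (a, w) T : Fin (k + 1) → (Fin k → R) × R))) = coin := by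
    intro a
    simp only [Function.comp_def, hred]
    rw [PMF.bind_comm (PMF.uniformOfFintype R)]
    have h2 : ∀ T : Fin k → (Fin k → R) × R,
        ((PMF.uniformOfFintype R).bind fun w ↦ (A.choose (fun i ↦ (fun j ↦ (T j).1 i, a i))).bind fun m ↦
          coin.bind fun b ↦ (A.guess m.2.2 (fun j ↦ (T j).2, w + pick b m)).map fun b' ↦ (b' == b)) =
        coin := by
      intro T
      rw [PMF.bind_comm (PMF.uniformOfFintype R)]
      have h3 : ∀ m : R × R × A.St,
          ((PMF.uniformOfFintype R).bind fun w ↦ coin.bind fun b ↦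
            (A.guess m.2.2 (fun j ↦ (T j).2, w + pick b m)).map fun b' ↦ (b' == b)) = coin := by
        intro m
        rw [PMF.bind_comm (PMF.uniformOfFintype R)]
        have h4 : ∀ b : Bool, ((PMF.uniformOfFintype R).bind fun w ↦
            (A.guess m.2.2 (fun j ↦ (T j).2, w + pick b m)).map fun b' ↦ (b' == b)) =
            ((PMF.uniformOfFintype R).bind fun w ↦ A.guess m.2.2 (fun j ↦ (T j).2, w)).map
              fun b' ↦ (b' == b) := by
          intro b
          rw [htrans (pick b m) (fun w ↦ (A.guess m.2.2 (fun j ↦ (T j).2, w)).map fun b' ↦ (b' == b)),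
            PMF.map_bind]
        simp_rw [h4]
        exact coin_bind_map_beq _
      simp_rw [h3]
      exact PMF.bind_const _ _
    simp_rw [h2]
    exact PMF.bind_const _ _
  simp_rw [hinner]
  exact PMF.bind_const _ _

/-- `coin` gives `true` with probability `1/2`. [cite: AvanziEtAl2021KyberSpec, §4.3.1 Thm 1 (Adv^cpa = |Pr − 1/2|)] -/
theorem coin_true_toReal : (coin true).toReal = 1 / 2 := by
  rw [coin, PMF.uniformOfFintype_apply, Fintype.card_bool]
  norm_num

/-- **Theorem 1, two-term form**: `Adv^{cpa}(A) ≤ Adv^{mlwe}_{k,k}(B₁) + Adv^{mlwe}_{k+1,k}(B₂)` with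
the explicit `B₁ = redKey A`, `B₂ = redCipher A` (MLWE in normal form: secret and errors from `χ`).
[cite: AvanziEtAl2021KyberSpec, §4.3.1 Thm 1] -/
theorem cpaAdvantage_le (A : CPAAdversary R k) :
    cpaAdvantage χ k A ≤
      LWE.advantageSecretLaw χ (LWE.iidPMF χ k) k (redKey χ k A) +
        LWE.advantageSecretLaw χ (LWE.iidPMF χ k) (k + 1) (redCipher k A) := by
  unfold cpaAdvantage LWE.advantageSecretLaw LWE.acceptProb
  rw [cpaGame_eq, hybrid_eq, uniform_bind_redCipher, coin_true_toReal]
  exact abs_sub_le _ _ _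

/-- **More samples never hurt**: a distinguisher on `m` samples is one on `m + 1` samples (ignore sample
`0`) with the same advantage, `Adv^{mlwe}_{m,k}(D) = Adv^{mlwe}_{m+1,k}(D ∘ tail)`.
[cite: RegevLWE2009, §2 (m independent samples)] -/
theorem advantage_dropSample (m : ℕ) (D : LWE.Distinguisher (Fin k) R m) :
    LWE.advantageSecretLaw χ (LWE.iidPMF χ k) (m + 1) (fun S ↦ D (Fin.tail S)) =
      LWE.advantageSecretLaw χ (LWE.iidPMF χ k) m D := by
  unfold LWE.advantageSecretLaw LWE.acceptProb
  have h1 : (LWE.lweSamplesSecretLaw χ (LWE.iidPMF χ k) (m + 1)).bind (fun S ↦ D (Fin.tail S)) =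
      (LWE.lweSamplesSecretLaw χ (LWE.iidPMF χ k) m).bind D := by
    rw [LWE.lweSamplesSecretLaw, LWE.lweSamplesSecretLaw, PMF.bind_bind, PMF.bind_bind]
    refine congrArg _ (funext fun s ↦ ?_)
    rw [show (fun S : Fin (m + 1) → (Fin k → R) × R ↦ D (Fin.tail S)) = D ∘ (fun S ↦ Fin.tail S) from rfl,
      ← PMF.bind_map, LWE.lweSamples, LWE.iidPMF_succ_map_tail]
    rfl
  have h2 : (LWE.uniformSamples (Fin k) R (m + 1)).bind (fun S ↦ D (Fin.tail S)) =
      (LWE.uniformSamples (Fin k) R m).bind D := by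
    rw [show (fun S : Fin (m + 1) → (Fin k → R) × R ↦ D (Fin.tail S)) = D ∘ (fun S ↦ Fin.tail S) from rfl,
      ← PMF.bind_map, LWE.uniformSamples_eq_iidPMF_holds, LWE.iidPMF_succ_map_tail,
      ← LWE.uniformSamples_eq_iidPMF_holds]
  rw [h1, h2]

/-- **Kyber specification Theorem 1 (idealised model, algebraic skeleton)**: for every IND-CPA adversary
`A` there is a Module-LWE distinguisher `B` on `k + 1` normal-form samples with
`Adv^{cpa}_{Kyber.CPAPKE}(A) ≤ 2 · Adv^{mlwe}_{k+1,k}(B)` — `B` is the better of `redKey A ∘ tail` and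
`redCipher A`. (The printed `Adv^{prf}_{PRF}(C)` term accounts for deriving the noise from a seed, which
this idealised model samples truly at random.) [cite: AvanziEtAl2021KyberSpec, §4.3.1 Thm 1] -/
theorem exists_cpaAdvantage_le_two_mul (A : CPAAdversary R k) :
    ∃ B : LWE.Distinguisher (Fin k) R (k + 1),
      cpaAdvantage χ k A ≤ 2 * LWE.advantageSecretLaw χ (LWE.iidPMF χ k) (k + 1) B := by
  have h := cpaAdvantage_le χ k A
  rw [← advantage_dropSample χ k k (redKey χ k A)] at h
  set a₁ := LWE.advantageSecretLaw χ (LWE.iidPMF χ k) (k + 1) (fun S ↦ redKey χ k A (Fin.tail S))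
  set a₂ := LWE.advantageSecretLaw χ (LWE.iidPMF χ k) (k + 1) (redCipher k A)
  rcases le_total a₁ a₂ with h12 | h21
  · exact ⟨redCipher k A, by linarith⟩
  · exact ⟨fun S ↦ redKey χ k A (Fin.tail S), by linarith⟩

/-! ### Two noise laws: `s, e, r ← χ₁`, `e₁, e₂ ← χ₂` (the Kyber512 shape, §1.4 p. 11) -/

section TwoLaws

variable (χ₁ χ₂ : PMF R)

/-- **Kyber.CPAPKE.Enc with the two widths of §1.4**: `r ← χ₁^k` (width `η₁`), `e₁ ← χ₂^k`, `e₂ ← χ₂`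
(width `η₂`); `(u, v) = (Aᵀr + e₁, tᵀr + e₂ + μ)`. [cite: AvanziEtAl2021KyberSpec, §1.4 p. 11 ("η₁ defines the noise of s and e in Algorithm 4 and of r in Algorithm 5. The parameter η₂ defines the noise of e₁ and e₂")] -/
def enc₂ (pk : PubKey R k) (μ : R) : PMF (Cipher R k) :=
  (LWE.iidPMF χ₁ k).bind fun r ↦ (LWE.iidPMF χ₂ k).bind fun e₁ ↦ χ₂.map fun e₂ ↦ encDet k pk μ r e₁ e₂

omit [Fintype R] in
/-- One law: `enc₂ χ χ = enc χ`. [cite: AvanziEtAl2021KyberSpec, §1 Algorithm 5] -/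
theorem enc₂_self : enc₂ k χ χ = enc χ k := rfl

/-- The IND-CPA game of the two-law scheme (`KeyGen` with `χ₁` for `s, e`; `Enc` with `χ₁, χ₂`).
[cite: AvanziEtAl2021KyberSpec, §4.3.1 Thm 1 with §4.4 eq. (6)] -/
def cpaGame₂ (A : CPAAdversary R k) : PMF Bool :=
  (keyGen χ₁ k).bind fun ks ↦ (A.choose ks.1).bind fun m ↦ coin.bind fun b ↦
    (enc₂ k χ₁ χ₂ ks.1 (pick b m)).bind fun c ↦ (A.guess m.2.2 c).map fun b' ↦ (b' == b)

/-- `Adv^{cpa}(A) = |Pr[b′ = b] − 1/2|` for the two-law scheme. [cite: AvanziEtAl2021KyberSpec, §4.3.1 Thm 1 with §4.4 eq. (6)] -/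
def cpaAdvantage₂ (A : CPAAdversary R k) : ℝ := |(cpaGame₂ k χ₁ χ₂ A true).toReal - 1 / 2|

/-- One law: `cpaGame₂ χ χ = cpaGame χ`. [cite: AvanziEtAl2021KyberSpec, §4.3.1 Thm 1] -/
theorem cpaGame₂_self (A : CPAAdversary R k) : cpaGame₂ k χ χ A = cpaGame χ k A := rfl

/-- One law: `cpaAdvantage₂ χ χ = cpaAdvantage χ`. [cite: AvanziEtAl2021KyberSpec, §4.3.1 Thm 1] -/
theorem cpaAdvantage₂_self (A : CPAAdversary R k) : cpaAdvantage₂ k χ χ A = cpaAdvantage χ k A := rfl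

/-- The two-parameter MLWE advantage (secret law `χ₁^k`, error law `χ₂`) is the tree's
`RingLWE.binomialMLWEAdvantage₂` for centred binomial laws — definitionally.
[cite: AvanziEtAl2021KyberSpec, §4.4 (Adv^mlwer: (s, e) ← β^k_{η₁} × β^m_{η₂})] -/
theorem advantageSecretLaw_binomialRq₂ {K : Type} [Field K] [NumberField K] {n : ℕ}
    (b : Module.Basis (Fin n) ℤ (NumberField.RingOfIntegers K)) (q : ℕ) [NeZero q] (k η₁ η₂ m : ℕ)
    (D : LWE.Distinguisher (Fin k) (RingLWE.Rq K q) m) :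
    LWE.advantageSecretLaw (RingLWE.binomialRq b q η₂) (LWE.iidPMF (RingLWE.binomialRq b q η₁) k) m D =
      RingLWE.binomialMLWEAdvantage₂ b q k η₁ η₂ m D := rfl

/-- `B₁` for the two-law scheme (public key pseudo-random). [cite: AvanziEtAl2021KyberSpec, §4.3.1 Thm 1 (proof) with §4.4 eq. (6)] -/
def redKey₂ (A : CPAAdversary R k) : LWE.Distinguisher (Fin k) R k :=
  fun pk ↦ (A.choose pk).bind fun m ↦ coin.bind fun b ↦
    (enc₂ k χ₁ χ₂ pk (pick b m)).bind fun c ↦ (A.guess m.2.2 c).map fun b' ↦ (b' == b)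

omit [Fintype R] in
/-- One law: `redKey₂ χ χ = redKey χ`. [cite: AvanziEtAl2021KyberSpec, §4.3.1 Thm 1 (proof)] -/
theorem redKey₂_self (A : CPAAdversary R k) : redKey₂ k χ χ A = redKey χ k A := rfl

/-- Hybrid 0, two laws: the real game is `B₁` on `k` MLWE samples with secret and error law `χ₁`.
[cite: AvanziEtAl2021KyberSpec, §4.3.1 Thm 1 (proof) with §4.4 eq. (6)] -/
theorem cpaGame₂_eq (A : CPAAdversary R k) :
    cpaGame₂ k χ₁ χ₂ A = (LWE.lweSamplesSecretLaw χ₁ (LWE.iidPMF χ₁ k) k).bind (redKey₂ k χ₁ χ₂ A) := by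
  rw [cpaGame₂, keyGen, LWE.lweSamplesSecretLaw, PMF.bind_bind, PMF.bind_bind]
  refine congrArg _ (funext fun s ↦ ?_)
  rw [PMF.bind_map]
  rfl

/-- Hybrid 1 = Hybrid 1′, two laws: `B₁` on a uniform public key = `B₂` on `k + 1` MLWE samples with
secret `r ← χ₁^k` and errors `(e₂, e₁) ← χ₂^{k+1}`. [cite: AvanziEtAl2021KyberSpec, §4.3.1 Thm 1 (proof) with §4.4 eq. (6)] -/
theorem hybrid₂_eq (A : CPAAdversary R k) :
    (LWE.uniformSamples (Fin k) R k).bind (redKey₂ k χ₁ χ₂ A) =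
      (LWE.lweSamplesSecretLaw χ₂ (LWE.iidPMF χ₁ k) (k + 1)).bind (redCipher k A) := by
  classical
  set U := LWE.iidPMF (PMF.uniformOfFintype (Fin k → R)) (k + 1) with hU
  have hR : (LWE.lweSamplesSecretLaw χ₂ (LWE.iidPMF χ₁ k) (k + 1)).bind (redCipher k A) =
      (LWE.iidPMF χ₁ k).bind fun r ↦ U.bind fun A' ↦ χ₂.bind fun e₂ ↦ (LWE.iidPMF χ₂ k).bind fun e₁ ↦
        (A.choose (pkOfA k A')).bind fun m ↦ coin.bind fun b ↦ body k A A' m b r e₁ e₂ := by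
    rw [LWE.lweSamplesSecretLaw, PMF.bind_bind]
    refine congrArg _ (funext fun r ↦ ?_)
    rw [LWE.lweSamples_eq_uniform_bind_noise, PMF.bind_bind]
    refine congrArg _ (funext fun A' ↦ ?_)
    rw [PMF.bind_map, LWE.iidPMF_succ, PMF.bind_bind]
    refine congrArg _ (funext fun e₂ ↦ ?_)
    rw [PMF.bind_map]
    rfl
  have hL : (LWE.uniformSamples (Fin k) R k).bind (redKey₂ k χ₁ χ₂ A) =
      U.bind fun A' ↦ (A.choose (pkOfA k A')).bind fun m ↦ coin.bind fun b ↦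
        (LWE.iidPMF χ₁ k).bind fun r ↦ (LWE.iidPMF χ₂ k).bind fun e₁ ↦ χ₂.bind fun e₂ ↦
          body k A A' m b r e₁ e₂ := by
    rw [uniformSamples_eq_map_pkOfA, PMF.bind_map]
    refine congrArg _ (funext fun A' ↦ ?_)
    simp only [Function.comp_apply, redKey₂, enc₂, PMF.bind_bind, PMF.bind_map]
    rfl
  have c1 : ∀ (A' : Fin (k + 1) → Fin k → R) (m : R × R × A.St),
      (coin.bind fun b ↦ (LWE.iidPMF χ₁ k).bind fun r ↦ (LWE.iidPMF χ₂ k).bind fun e₁ ↦ χ₂.bind fun e₂ ↦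
        body k A A' m b r e₁ e₂) =
      (LWE.iidPMF χ₁ k).bind fun r ↦ (LWE.iidPMF χ₂ k).bind fun e₁ ↦ χ₂.bind fun e₂ ↦ coin.bind fun b ↦
        body k A A' m b r e₁ e₂ := by
    intro A' m
    rw [PMF.bind_comm coin]
    refine congrArg _ (funext fun r ↦ ?_)
    rw [PMF.bind_comm coin]
    refine congrArg _ (funext fun e₁ ↦ ?_)
    rw [PMF.bind_comm coin]
  have c2 : ∀ (A' : Fin (k + 1) → Fin k → R),
      ((A.choose (pkOfA k A')).bind fun m ↦ (LWE.iidPMF χ₁ k).bind fun r ↦ (LWE.iidPMF χ₂ k).bind fun e₁ ↦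
        χ₂.bind fun e₂ ↦ coin.bind fun b ↦ body k A A' m b r e₁ e₂) =
      (LWE.iidPMF χ₁ k).bind fun r ↦ (LWE.iidPMF χ₂ k).bind fun e₁ ↦ χ₂.bind fun e₂ ↦
        (A.choose (pkOfA k A')).bind fun m ↦ coin.bind fun b ↦ body k A A' m b r e₁ e₂ := by
    intro A'
    rw [PMF.bind_comm (A.choose _)]
    refine congrArg _ (funext fun r ↦ ?_)
    rw [PMF.bind_comm (A.choose _)]
    refine congrArg _ (funext fun e₁ ↦ ?_)
    rw [PMF.bind_comm (A.choose _)]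
  rw [hL, hR]
  simp_rw [c1, c2]
  rw [PMF.bind_comm U]
  refine congrArg _ (funext fun r ↦ ?_)
  refine congrArg _ (funext fun A' ↦ ?_)
  rw [PMF.bind_comm (LWE.iidPMF χ₂ k) χ₂]

/-- **Two-law IND-CPA bound (the exactly provable form behind Kyber's eq. (6))**:
`Adv^{cpa}(A) ≤ Adv^{mlwe}_{k,k,χ₁,χ₁}(redKey₂ A) + Adv^{mlwe}_{k+1,k,χ₁,χ₂}(redCipher A)` — the key term
has secret AND error law `χ₁` (`η₁`), the ciphertext term has secret law `χ₁` (`r`) and error law `χ₂`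
(`e₁, e₂`). For `χ₁ = χ₂` this is `cpaAdvantage_le`. The specification's eq. (6) further replaces the
second term by a Module-LWER advantage (compressed ciphertext), which is not typed here.
[cite: AvanziEtAl2021KyberSpec, §4.3.1 Thm 1 with §1.4 p. 11 and §4.4 eq. (6)] -/
theorem cpaAdvantage₂_le (A : CPAAdversary R k) :
    cpaAdvantage₂ k χ₁ χ₂ A ≤
      LWE.advantageSecretLaw χ₁ (LWE.iidPMF χ₁ k) k (redKey₂ k χ₁ χ₂ A) +
        LWE.advantageSecretLaw χ₂ (LWE.iidPMF χ₁ k) (k + 1) (redCipher k A) := by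
  unfold cpaAdvantage₂ LWE.advantageSecretLaw LWE.acceptProb
  rw [cpaGame₂_eq, hybrid₂_eq, uniform_bind_redCipher, coin_true_toReal]
  exact abs_sub_le _ _ _

end TwoLaws

end KyberPKE

/-! ### The ML-KEM instance -/

namespace MLKEM

open NumberField

/-- **ML-KEM / Kyber, Theorem 1 of the specification (idealised model, algebraic skeleton)** over
`R_q = ℤ_3329[X]/(X^256 + 1)` realised as `𝓞(ℚ(ζ_512)) ⧸ (3329)` with the power basis, noise
`D_η(R_q)` (`RingLWE.binomialRq`): for every IND-CPA adversary `A` against the skeleton of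
Kyber.CPAPKE with rank `k` there is `B` with `Adv^{cpa}(A) ≤ 2 · Adv^{mlwe}_{k+1,k,η}(B)`, the
right-hand side being the tree's `MLKEM.mlweAdvantage k η (k + 1) B` (the single-`η` statement as
printed: ML-KEM-768/1024 have `η₁ = η₂ = 2`, `k = 3, 4`; for ML-KEM-512's `η₁ = 3 ≠ η₂ = 2` see
`cpaPKE₂_le_mlweAdvantage_add`). [cite: AvanziEtAl2021KyberSpec, §4.3.1 Thm 1] -/
theorem cpaPKE_exists_le_two_mul_mlweAdvantage (k η : ℕ)
    (A : KyberPKE.CPAAdversary (RingLWE.Rq (CyclotomicField (2 ^ 9) ℚ) q) k) :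
    ∃ B : LWE.Distinguisher (Fin k) (RingLWE.Rq (CyclotomicField (2 ^ 9) ℚ) q) (k + 1),
      KyberPKE.cpaAdvantage (RingLWE.binomialRq (cyclotomicPowerBasis 9).basis q η) k A ≤
        2 * mlweAdvantage k η (k + 1) B :=
  KyberPKE.exists_cpaAdvantage_le_two_mul _ k A

/-- **ML-KEM-512 shape (`η₁ ≠ η₂`)**: over `R_q = 𝓞(ℚ(ζ_512)) ⧸ (3329)` with `s, e, r ← D_{η₁}(R_q)` and
`e₁, e₂ ← D_{η₂}(R_q)` (§1.4: ML-KEM-512 has `k = 2`, `η₁ = 3`, `η₂ = 2`), every IND-CPA adversary `A`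
satisfies `Adv^{cpa}(A) ≤ Adv^{mlwe}_{k,k,η₁}(redKey₂ A) + Adv^{mlwe}_{k+1,k,η₁,η₂}(redCipher A)` with the
tree's `MLKEM.mlweAdvantage` and `RingLWE.binomialMLWEAdvantage₂`. [cite: AvanziEtAl2021KyberSpec, §4.3.1 Thm 1 with §1.4 p. 11 and §4.4 eq. (6)] -/
theorem cpaPKE₂_le_mlweAdvantage_add (k η₁ η₂ : ℕ)
    (A : KyberPKE.CPAAdversary (RingLWE.Rq (CyclotomicField (2 ^ 9) ℚ) q) k) :
    KyberPKE.cpaAdvantage₂ k (RingLWE.binomialRq (cyclotomicPowerBasis 9).basis q η₁)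
        (RingLWE.binomialRq (cyclotomicPowerBasis 9).basis q η₂) A ≤
      mlweAdvantage k η₁ k
          (KyberPKE.redKey₂ k (RingLWE.binomialRq (cyclotomicPowerBasis 9).basis q η₁)
            (RingLWE.binomialRq (cyclotomicPowerBasis 9).basis q η₂) A) +
        RingLWE.binomialMLWEAdvantage₂ (cyclotomicPowerBasis 9).basis q k η₁ η₂ (k + 1)
          (KyberPKE.redCipher k A) :=
  KyberPKE.cpaAdvantage₂_le k _ _ A

end MLKEM

end Literature.Computability.Cryptography
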